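import Literature.NumberTheory.EllipticCurves.HeegnerPoints
import Literature.NumberTheory.QuadraticFields.KroneckerSplitting
import HarnessLib

/-!
# The Heegner hypothesis as a Kronecker-symbol condition: `ℓ` splits in `K` iff `χ_{d_K}(ℓ) = 1`

Proof companion of `Literature/NumberTheory/EllipticCurves/HeegnerPoints.lean` (the predicate
`Literature.SatisfiesHeegnerHypothesis N K`: every prime `p ∣ N` has exactly two primes of `𝓞 K`
above it; Darmon 2004, Hypothesis 3.9; Gross 1991, §1). Everything here is PROVED.

For a quadratic field `K` (`[K : ℚ] = 2`; in the applications an imaginary quadratic field) with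
discriminant `d_K`, the decomposition law of
`Literature/NumberTheory/QuadraticFields/KroneckerSplitting.lean` (`p` splits iff
`(d_K/p) = 1` for odd `p`, resp. `d_K ≡ 1 (mod 8)` for `p = 2`) turns the Heegner hypothesis into
the character condition under which the analytic literature states the non-vanishing theorems
for quadratic twists — Darmon 2004, §3.9, proof of Thm. 3.22, condition (1) "`ε(ℓ) = 1` for all
`ℓ ∣ N`" on the quadratic character `ε = χ_{d_K}`; Gross–Zagier 1986, I.§3 and Gross–Kohnen–Zagier
"`D ≡ square (mod 4N)`"; Murty–Murty 1991, Corollary p. 449 "all primes dividing the conductor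
of `E` split completely in `ℚ(√D)`":

* `satisfiesHeegnerHypothesis_iff_kronecker` — `SatisfiesHeegnerHypothesis N K ↔ ∀ p prime,
  p ∣ N → (p = 2 → d_K % 8 = 1) ∧ (p ≠ 2 → jacobiSym d_K p = 1)`;
* dot-notation corollaries on `Literature.SatisfiesHeegnerHypothesis` (declared with their
  absolute names, the structure living in `HeegnerPoints.lean`): `discr_emod_eight`,
  `jacobiSym_discr_eq_one`, `not_dvd_discr` (a split prime does not divide `d_K`, i.e. is
  unramified) and `coprime_discr` (`(N, d_K) = 1`, the standing hypothesis "`(D, N) = 1`" of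
  Gross–Zagier 1986, I.(3.1), Ireland–Rosen Thm. 20.5.3, Murty–Murty 1997, Ch. 6).

`HeegnerCondition.lean` (`QuadraticFields/`) has the related consequence `d_K ≡ β² (mod 4N)`;
the converse direction (from the character condition back to splitting) is new here.

## References

* [Darmon2004] H. Darmon, *Rational points on modular elliptic curves*, CBMS 101 (2004),
  Hypothesis 3.9 (p. 35) and §3.9, proof of Thm. 3.22, (1) (p. 40).
* [GrossZagierInvent1986] B. H. Gross, D. B. Zagier, Invent. Math. 84 (1986), I.§3, (3.1)–(3.2).
* [MurtyMurty1991] M. R. Murty, V. K. Murty, Ann. of Math. 133 (1991), Corollary p. 449.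
* [Marcus2018] D. A. Marcus, *Number Fields*, Ch. 3, Thm. 25 (decomposition law).
-/

noncomputable section

open NumberField

namespace Literature.NumberTheory.EllipticCurves

variable (N : ℕ) (K : Type*) [Field K] [NumberField K]

/-- **Heegner hypothesis ⟺ `χ_{d_K}(p) = 1` for all primes `p ∣ N`** (any quadratic field `K`):
every prime dividing `N` splits in `K` iff the Kronecker symbol `(d_K/p)` is `1` at every prime
`p ∣ N`, i.e. `jacobiSym d_K p = 1` for odd `p` and `d_K ≡ 1 (mod 8)` for `p = 2` — the
decomposition law in quadratic fields (`QuadraticFields.Quadratic.ncard_primesOver_eq_two_iff_jacobiSym`,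
`QuadraticFields.Quadratic.ncard_primesOver_two_eq_two_iff`; Marcus, *Number Fields*, Ch. 3,
Thm. 25). This is the passage between Darmon's condition (1) of §3.9 and his Hypothesis 3.9.
[folklore] -/
theorem satisfiesHeegnerHypothesis_iff_kronecker (h2 : Module.finrank ℚ K = 2) :
    SatisfiesHeegnerHypothesis N K ↔
      ∀ p : ℕ, p.Prime → p ∣ N →
        (p = 2 → NumberField.discr K % 8 = 1) ∧ (p ≠ 2 → jacobiSym (NumberField.discr K) p = 1) := by
  refine forall₃_congr fun p hp _ => ?_
  by_cases hp2 : p = 2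
  · subst hp2
    rw [← QuadraticFields.Quadratic.ncard_primesOver_two_eq_two_iff h2]
    simp
  · rw [← QuadraticFields.Quadratic.ncard_primesOver_eq_two_iff_jacobiSym h2 hp hp2]
    simp [hp2]

variable {N K}

/-- Under the Heegner hypothesis with `2 ∣ N` (so `2` splits in `K`): `d_K ≡ 1 (mod 8)`. [folklore] -/
theorem _root_.Literature.SatisfiesHeegnerHypothesis.discr_emod_eight
    (h2 : Module.finrank ℚ K = 2) (hH : SatisfiesHeegnerHypothesis N K) (hN : 2 ∣ N) :
    NumberField.discr K % 8 = 1 :=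
  (((satisfiesHeegnerHypothesis_iff_kronecker N K h2).mp hH) 2 Nat.prime_two hN).1 rfl

/-- Under the Heegner hypothesis, `(d_K/p) = 1` for every odd prime `p ∣ N` (Darmon 2004, §3.9,
condition (1): `ε(ℓ) = 1` for `ℓ ∣ N`). [folklore] -/
theorem _root_.Literature.SatisfiesHeegnerHypothesis.jacobiSym_discr_eq_one
    (h2 : Module.finrank ℚ K = 2) (hH : SatisfiesHeegnerHypothesis N K) {p : ℕ} (hp : p.Prime)
    (hpN : p ∣ N) (hp2 : p ≠ 2) : jacobiSym (NumberField.discr K) p = 1 :=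
  (((satisfiesHeegnerHypothesis_iff_kronecker N K h2).mp hH) p hp hpN).2 hp2

/-- Under the Heegner hypothesis no prime dividing `N` divides `d_K` (split primes are unramified).
[folklore] -/
theorem _root_.Literature.SatisfiesHeegnerHypothesis.not_dvd_discr
    (h2 : Module.finrank ℚ K = 2) (hH : SatisfiesHeegnerHypothesis N K) {p : ℕ} (hp : p.Prime)
    (hpN : p ∣ N) : ¬ (p : ℤ) ∣ NumberField.discr K := by
  intro hdvd
  by_cases hp2 : p = 2
  · subst hp2
    have h8 := Literature.SatisfiesHeegnerHypothesis.discr_emod_eight h2 hH hpN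
    omega
  · have hj := Literature.SatisfiesHeegnerHypothesis.jacobiSym_discr_eq_one h2 hH hp hpN hp2
    haveI : NeZero p := ⟨hp.ne_zero⟩
    have h0 : jacobiSym (NumberField.discr K) p = 0 := by
      rw [jacobiSym.mod_left, Int.emod_eq_zero_of_dvd hdvd, jacobiSym.zero_left hp.one_lt]
    rw [h0] at hj
    exact zero_ne_one hj

/-- Under the Heegner hypothesis `(N, d_K) = 1` — the standing hypothesis "`(D, N) = 1`" of
Gross–Zagier 1986, I.(3.1) and Ireland–Rosen, Thm. 20.5.3, which is thus implied by "every
`p ∣ N` splits in `K`". [folklore] -/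
theorem _root_.Literature.SatisfiesHeegnerHypothesis.coprime_discr
    (h2 : Module.finrank ℚ K = 2) (hH : SatisfiesHeegnerHypothesis N K) :
    Nat.Coprime N (NumberField.discr K).natAbs := by
  exact Nat.coprime_of_dvd fun k hk hkN hkd =>
    Literature.SatisfiesHeegnerHypothesis.not_dvd_discr h2 hH hk hkN (Int.natCast_dvd.mpr hkd)

end Literature.NumberTheory.EllipticCurves

end
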